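import Mathlib.Topology.EMetricSpace.BoundedVariation
import Mathlib.Analysis.SpecialFunctions.Pow.Continuity
import Mathlib.Analysis.MeanInequalitiesPow
import Mathlib.MeasureTheory.Constructions.BorelSpace.Order
import Mathlib.Topology.Hom.ContinuousEvalConst
import Literature.Probability.RandomPlanarGeometry.Curve
import Literature.Probability.RandomPlanarGeometry.CurveSpace
import Literature.Probability.RandomPlanarGeometry.CurveTortuosity
import HarnessLib

/-!
# The `p`-variation of a curve

Topic `Probability/RandomPlanarGeometry` (definition request `Curve.pVariation`, route
`SAWExpectedSignature` of `CriticalPhenomena/SAWScalingLimit`, items `PVarMoments`,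
`MomentsIdentifySLE`, `MomentsPassToLimit`, where the functional is inlined as `pv`).

For a curve `γ : Curve E` (`E` a pseudo-emetric space) and a real exponent `p`,

  `Curve.pVariation p γ = ⨆ (n, u) , ∑ i < n, edist (γ (u (i+1))) (γ (u i)) ^ p`,

the supremum over all finite monotone time sequences `u : ℕ → [0, 1]` — exactly the shape of
Mathlib's `eVariationOn` (the case `p = 1`, `Curve.pVariation_one`) and *literally* the `pv` of the
route items (`Curve.pVariation_eq_iSup` is `rfl`). In the notation of Friz–Victoir,
*Multidimensional stochastic processes as rough paths* (CUP 2010), Definition 5.1 (ii), eq. (5.2),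
`pVariation p γ = |γ|_{p-var;[0,1]} ^ p` (we do NOT take the `1/p`-th root: the items use the
un-rooted sum, which for `p ≥ 1` is the super-additive "control" `ω_{γ,p}` of [FV10, Prop. 5.8]).
Originally: L. C. Young, Acta Math. 67 (1936); N. Wiener (1924).

## Main results

* `Curve.pVariation_reparam`, `Curve.pVariation_eq_of_comp_monotone_surjective`: invariance under
  increasing reparametrisation ([FV10, Remark 1.22]); `Curve.pVariation_eq_of_dist_eq_zero`: two
  curves at reparametrisation distance `0` have the same `p`-variation, whence the functional
  `CurveClass.pVariation` on curves modulo reparametrisation (`CurveClass.pVariation_mk`,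
  `CurveClass.pVariation_choose` for the representative `(surjective_mk x).choose` used inline).
* `Curve.lowerSemicontinuous_pVariation`, `CurveClass.lowerSemicontinuous_pVariation`
  ([FV10, Lemma 5.12], here for the reparametrisation (pseudo-)metric): sublevel sets
  `{V_p ≤ M}` are closed and `V_p` is Borel measurable.
* `Curve.pVariation_one`: `V_1 = eVariationOn γ univ` (length); `Curve.pVariation_rpow_inv_anti`
  ([FV10, Prop. 5.3]): `V_q ^ (1/q) ≤ V_p ^ (1/p)` for `0 < p ≤ q`.
* `Curve.natCast_tortuosity_le_pVariation_div_add_one`: **finite `p`-variation is a tortuosity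
  bound**, `M(γ, 2ℓ) ≤ V_p(γ) / ℓ ^ p + 1` for `ℓ > 0` (the greedy first-exit division of
  `CurveTortuosity.lean`: its stopping points are `ℓ`-separated along the curve; cf.
  Aizenman–Burchard, Duke Math. J. 99 (1999) §2.b, `M(C, 3ℓ) ≤ M̃(C, ℓ)`), and hence
  `CurveClass.isCompact_closure_image_mk_of_pVariation_le`: classes of curves in a fixed compact
  set with `V_p ≤ M < ∞` are relatively compact (AB99 Lemma 4.1, proved in tree as
  `CurveClass.isCompact_closure_image_mk_of_tortuosity_le`).

## Not here (deliberately)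

The finite max formula for lattice polylines (sup attained at vertex times, by convexity of
`t ↦ d^p` along segments for `p ≥ 1`), super- and sub-additivity under concatenation (there is no
concatenation on `Curve` in tree yet), Young integration and signatures (request D2 of the route).
-/

open Set Filter
open scoped ENNReal NNReal unitInterval Topology

noncomputable section

namespace Literature.Probability.RandomPlanarGeometry

variable {E : Type*}

namespace Curve

/-! ### Definition and first properties -/

section EMetric

variable [PseudoEMetricSpace E]

/-- The **`p`-variation** of a curve `γ : [0,1] → E`, for a real exponent `p`:
`V_p(γ) = sup Σ_i edist (γ (t_{i+1})) (γ (t_i)) ^ p ∈ [0, ∞]`, the supremum over all finite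
monotone time sequences `t_0 ≤ t_1 ≤ ⋯` in `[0,1]` (indexed, as in Mathlib's `eVariationOn`, by
`ℕ × {u : ℕ → unitInterval // Monotone u}`). This is `|γ|_{p-var;[0,1]} ^ p` in the notation of
Friz–Victoir 2010, Definition 5.1 (ii), eq. (5.2) (no `1/p`-th root is taken); finite and
meaningful for `p ≥ 1` (for `p < 1` only constant curves have finite `p`-variation, FV Prop. 5.2;
for `p ≤ 0` the value is `⊤` as `0 ^ p ≥ 1`). [cite: FrizVictoir2010, Def. 5.1 (5.2)] -/
def pVariation (p : ℝ) (γ : Curve E) : ℝ≥0∞ :=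
  ⨆ π : ℕ × {u : ℕ → unitInterval // Monotone u},
    ∑ i ∈ Finset.range π.1, edist (γ (π.2.1 (i + 1))) (γ (π.2.1 i)) ^ p

/-- Unfolding `Curve.pVariation`: literally the functional `pv` inlined in the items of route
`SAWExpectedSignature` (Friz–Victoir 2010, Def. 5.1 (5.2)). [cite: FrizVictoir2010, Def. 5.1 (5.2)] -/
theorem pVariation_eq_iSup (p : ℝ) (γ : Curve E) :
    pVariation p γ = ⨆ π : ℕ × {u : ℕ → unitInterval // Monotone u},
      ∑ i ∈ Finset.range π.1, edist (γ (π.2.1 (i + 1))) (γ (π.2.1 i)) ^ p :=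
  rfl

/-- Every partition sum is bounded by the `p`-variation (Friz–Victoir 2010, Def. 5.1). [cite: FrizVictoir2010, Def. 5.1 (5.2)] -/
theorem sum_le_pVariation (p : ℝ) (γ : Curve E) (n : ℕ) {u : ℕ → I} (hu : Monotone u) :
    ∑ i ∈ Finset.range n, edist (γ (u (i + 1))) (γ (u i)) ^ p ≤ pVariation p γ :=
  le_iSup_of_le (f := fun π : ℕ × {u : ℕ → unitInterval // Monotone u} ↦
    ∑ i ∈ Finset.range π.1, edist (γ (π.2.1 (i + 1))) (γ (π.2.1 i)) ^ p) ⟨n, u, hu⟩ le_rfl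

/-- A single increment is bounded by the `p`-variation: `edist (γ t) (γ s) ^ p ≤ V_p(γ)`
(Friz–Victoir 2010, proof of Lemma 5.13, eq. (5.9)). [cite: FrizVictoir2010, Lemma 5.13 (5.9)] -/
theorem edist_rpow_le_pVariation (p : ℝ) (γ : Curve E) (s t : I) :
    edist (γ t) (γ s) ^ p ≤ pVariation p γ := by
  wlog hst : s ≤ t generalizing s t
  · rw [edist_comm]
    exact this t s (le_of_not_ge hst)
  let u : ℕ → I := fun n ↦ if n = 0 then s else t
  have hu : Monotone u := monotone_nat_of_le_succ fun n ↦ by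
    rcases n with _ | n <;> simp [u, hst]
  simpa [u] using sum_le_pVariation p γ 1 hu

/-- Composition with a monotone map of the parameter interval does not increase the
`p`-variation: if `γ₁ = γ₂ ∘ φ` with `φ` monotone then `V_p(γ₁) ≤ V_p(γ₂)`
(Friz–Victoir 2010, Remark 1.22: invariance of variation norms under reparametrisation). [cite: FrizVictoir2010, Remark 1.22] -/
theorem pVariation_le_of_comp_monotone (p : ℝ) {γ₁ γ₂ : Curve E} {φ : I → I} (hφ : Monotone φ)
    (h : ∀ t, γ₁ t = γ₂ (φ t)) : pVariation p γ₁ ≤ pVariation p γ₂ := by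
  refine iSup_le fun π ↦ ?_
  obtain ⟨n, u, hu⟩ := π
  simp only [h]
  exact sum_le_pVariation p γ₂ n (hφ.comp hu)

/-- **Reparametrisation invariance**, general form: if `γ₁ = γ₂ ∘ φ` with `φ` monotone AND
surjective then `V_p(γ₁) = V_p(γ₂)` (pull a partition of `γ₂` back along canonical preimages,
which are automatically in increasing order) (Friz–Victoir 2010, Remark 1.22). [cite: FrizVictoir2010, Remark 1.22] -/
theorem pVariation_eq_of_comp_monotone_surjective (p : ℝ) {γ₁ γ₂ : Curve E} {φ : I → I}
    (hφ : Monotone φ) (hsurj : Function.Surjective φ) (h : ∀ t, γ₁ t = γ₂ (φ t)) :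
    pVariation p γ₁ = pVariation p γ₂ := by
  refine le_antisymm (pVariation_le_of_comp_monotone p hφ h) (iSup_le fun π ↦ ?_)
  obtain ⟨n, u, hu⟩ := π
  set v : ℕ → I := Function.surjInv hsurj ∘ u with hv
  have hφv : ∀ i, φ (v i) = u i := fun i ↦ Function.surjInv_eq hsurj (u i)
  have hvm : Monotone v := by
    intro i j hij
    rcases (hu hij).lt_or_eq with hlt | heq
    · by_contra hlt'
      have hle := hφ (not_le.1 hlt').le
      rw [hφv, hφv] at hle
      exact hlt.not_ge hle
    · exact le_of_eq (by simp [hv, heq])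
  calc ∑ i ∈ Finset.range n, edist (γ₂ (u (i + 1))) (γ₂ (u i)) ^ p
      = ∑ i ∈ Finset.range n, edist (γ₁ (v (i + 1))) (γ₁ (v i)) ^ p := by simp only [h, hφv]
    _ ≤ pVariation p γ₁ := sum_le_pVariation p γ₁ n hvm

/-- **Reparametrisation invariance**: `V_p(γ ∘ φ) = V_p(γ)` for every increasing homeomorphism
`φ` of `[0,1]` (Friz–Victoir 2010, Remark 1.22). [cite: FrizVictoir2010, Remark 1.22] -/
@[simp] theorem pVariation_reparam (p : ℝ) (γ : Curve E) (φ : I ≃o I) :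
    pVariation p (γ.reparam φ) = pVariation p γ :=
  pVariation_eq_of_comp_monotone_surjective p φ.monotone φ.surjective fun _ ↦ rfl

/-- Constant curves have zero `p`-variation for `p > 0` (Friz–Victoir 2010, remark after
Def. 5.1: `|x|_{p-var} = 0` iff `x` is constant). [cite: FrizVictoir2010, Def. 5.1] -/
theorem pVariation_const {p : ℝ} (hp : 0 < p) (x : E) : pVariation p (const x) = 0 := by
  refine le_antisymm (iSup_le fun π ↦ ?_) bot_le
  simp [ENNReal.zero_rpow_of_pos hp]

/-- **`V_1` is the length**: for `p = 1` the `p`-variation is Mathlib's total variation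
`eVariationOn γ univ` of the parametrisation (Friz–Victoir 2010, §1.2 and Def. 5.1). [cite: FrizVictoir2010, Def. 5.1 (5.2)] -/
theorem pVariation_one (γ : Curve E) : pVariation 1 γ = eVariationOn γ Set.univ := by
  simp only [pVariation, eVariationOn, ENNReal.rpow_one]
  refine le_antisymm (iSup_le ?_) (iSup_le ?_)
  · rintro ⟨n, u, hu⟩
    exact le_iSup_of_le (f := fun π : ℕ × {u : ℕ → I // Monotone u ∧ ∀ i, u i ∈ Set.univ} ↦
      ∑ i ∈ Finset.range π.1, edist (γ (π.2.1 (i + 1))) (γ (π.2.1 i)))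
      ⟨n, u, hu, fun _ ↦ Set.mem_univ _⟩ le_rfl
  · rintro ⟨n, u, hu, -⟩
    exact le_iSup_of_le (f := fun π : ℕ × {u : ℕ → I // Monotone u} ↦
      ∑ i ∈ Finset.range π.1, edist (γ (π.2.1 (i + 1))) (γ (π.2.1 i))) ⟨n, u, hu⟩ le_rfl

/-! ### Monotonicity in the exponent (Friz–Victoir Prop. 5.3) -/

/-- The elementary inequality behind Friz–Victoir 2010, Prop. 5.3: for `0 < p ≤ q` and
`a_i ∈ [0, ∞]`, `(Σ a_i ^ q) ^ (1/q) ≤ (Σ a_i ^ p) ^ (1/p)` (induction on the two-term case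
`ENNReal.rpow_add_rpow_le`). [cite: FrizVictoir2010, Prop. 5.3 (proof)] -/
theorem sum_rpow_rpow_inv_anti (a : ℕ → ℝ≥0∞) (n : ℕ) {p q : ℝ} (hp : 0 < p) (hpq : p ≤ q) :
    (∑ i ∈ Finset.range n, a i ^ q) ^ (1 / q) ≤ (∑ i ∈ Finset.range n, a i ^ p) ^ (1 / p) := by
  have hq : 0 < q := hp.trans_le hpq
  induction n with
  | zero => simp [ENNReal.zero_rpow_of_pos (inv_pos.2 hq)]
  | succ n ih =>
    rw [Finset.sum_range_succ, Finset.sum_range_succ]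
    set A := ∑ i ∈ Finset.range n, a i ^ q
    set B := ∑ i ∈ Finset.range n, a i ^ p
    have hA : (A ^ (1 / q)) ^ q = A := by rw [one_div, ENNReal.rpow_inv_rpow hq.ne']
    calc (A + a n ^ q) ^ (1 / q) = ((A ^ (1 / q)) ^ q + a n ^ q) ^ (1 / q) := by rw [hA]
      _ ≤ ((A ^ (1 / q)) ^ p + a n ^ p) ^ (1 / p) := ENNReal.rpow_add_rpow_le _ _ hp hpq
      _ ≤ (B + a n ^ p) ^ (1 / p) := by
          refine ENNReal.rpow_le_rpow (add_le_add ?_ le_rfl) (one_div_pos.2 hp).le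
          calc (A ^ (1 / q)) ^ p ≤ (B ^ (1 / p)) ^ p := ENNReal.rpow_le_rpow ih hp.le
            _ = B := by rw [one_div, ENNReal.rpow_inv_rpow hp.ne']

/-- `V_q ≤ (V_p ^ (1/p)) ^ q` for `0 < p ≤ q` (Friz–Victoir 2010, Prop. 5.3). [cite: FrizVictoir2010, Prop. 5.3] -/
theorem pVariation_le_rpow_rpow (γ : Curve E) {p q : ℝ} (hp : 0 < p) (hpq : p ≤ q) :
    pVariation q γ ≤ (pVariation p γ ^ (1 / p)) ^ q := by
  have hq : 0 < q := hp.trans_le hpq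
  refine iSup_le fun π ↦ ?_
  obtain ⟨n, u, hu⟩ := π
  calc ∑ i ∈ Finset.range n, edist (γ (u (i + 1))) (γ (u i)) ^ q
      = ((∑ i ∈ Finset.range n, edist (γ (u (i + 1))) (γ (u i)) ^ q) ^ (1 / q)) ^ q := by
        rw [one_div, ENNReal.rpow_inv_rpow hq.ne']
    _ ≤ ((∑ i ∈ Finset.range n, edist (γ (u (i + 1))) (γ (u i)) ^ p) ^ (1 / p)) ^ q :=
        ENNReal.rpow_le_rpow
          (sum_rpow_rpow_inv_anti (fun i ↦ edist (γ (u (i + 1))) (γ (u i))) n hp hpq) hq.le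
    _ ≤ (pVariation p γ ^ (1 / p)) ^ q :=
        ENNReal.rpow_le_rpow (ENNReal.rpow_le_rpow (sum_le_pVariation p γ n hu)
          (one_div_pos.2 hp).le) hq.le

/-- **Monotonicity in the exponent** (Friz–Victoir 2010, Prop. 5.3): `p ↦ V_p ^ (1/p)` is
non-increasing, `V_q ^ (1/q) ≤ V_p ^ (1/p)` for `0 < p ≤ q`. [cite: FrizVictoir2010, Prop. 5.3] -/
theorem pVariation_rpow_inv_anti (γ : Curve E) {p q : ℝ} (hp : 0 < p) (hpq : p ≤ q) :
    pVariation q γ ^ (1 / q) ≤ pVariation p γ ^ (1 / p) := by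
  have hq : 0 < q := hp.trans_le hpq
  calc pVariation q γ ^ (1 / q) ≤ ((pVariation p γ ^ (1 / p)) ^ q) ^ (1 / q) :=
        ENNReal.rpow_le_rpow (pVariation_le_rpow_rpow γ hp hpq) (one_div_pos.2 hq).le
    _ = pVariation p γ ^ (1 / p) := by rw [one_div q, ENNReal.rpow_rpow_inv hq.ne']

/-- Finite `p`-variation implies finite `q`-variation for `q ≥ p > 0`
(Friz–Victoir 2010, Prop. 5.3: `C^{p-var} ⊆ C^{q-var}`). [cite: FrizVictoir2010, Prop. 5.3] -/
theorem pVariation_ne_top_of_le (γ : Curve E) {p q : ℝ} (hp : 0 < p) (hpq : p ≤ q)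
    (h : pVariation p γ ≠ ⊤) : pVariation q γ ≠ ⊤ :=
  ne_top_of_le_ne_top
    (ENNReal.rpow_ne_top_of_nonneg (hp.trans_le hpq).le
      (ENNReal.rpow_ne_top_of_nonneg (one_div_pos.2 hp).le h))
    (pVariation_le_rpow_rpow γ hp hpq)

/-! ### Lower semicontinuity -/

/-- **Lower semicontinuity for uniform convergence of parametrisations**: on
`C(unitInterval, E)` (compact-open = uniform topology) the map `f ↦ V_p(f)` is lower
semicontinuous, as a supremum of continuous partition sums (Friz–Victoir 2010, Lemma 5.12, which
has it even for pointwise convergence). [cite: FrizVictoir2010, Lemma 5.12] -/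
theorem lowerSemicontinuous_pVariation_mk (p : ℝ) :
    LowerSemicontinuous fun f : C(I, E) ↦ pVariation p ⟨f⟩ := by
  refine lowerSemicontinuous_iSup fun π ↦ Continuous.lowerSemicontinuous ?_
  refine continuous_finsetSum _ fun i _ ↦ ENNReal.continuous_rpow_const.comp ?_
  exact (continuous_eval_const (π.2.1 (i + 1))).edist (continuous_eval_const (π.2.1 i))

end EMetric

section Metric

variable [PseudoMetricSpace E]

/-- **Lower semicontinuity on curve space** (reparametrisation pseudo-metric): if
`v < V_p(γ)` then `v < V_p(γ')` for all `γ'` close to `γ` — a partition sum of `γ` exceeding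
`v` is approximated by the corresponding partition sum of a uniformly close reparametrisation of
`γ'` (Friz–Victoir 2010, Lemma 5.12, combined with reparametrisation invariance). [cite: FrizVictoir2010, Lemma 5.12] -/
theorem lowerSemicontinuous_pVariation (p : ℝ) :
    LowerSemicontinuous (pVariation p : Curve E → ℝ≥0∞) := by
  intro γ v hv
  have hopen : IsOpen ((fun f : C(I, E) ↦ pVariation p ⟨f⟩) ⁻¹' Set.Ioi v) :=
    (lowerSemicontinuous_pVariation_mk p).isOpen_preimage v
  obtain ⟨ε, hε, hball⟩ := Metric.isOpen_iff.1 hopen γ.toContinuousMap hv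
  rw [Metric.eventually_nhds_iff]
  refine ⟨ε, hε, fun γ' hγ' ↦ ?_⟩
  rw [dist_comm] at hγ'
  obtain ⟨φ, hφ⟩ := exists_dist_reparam_lt hγ'
  have hmem : (γ'.reparam φ).toContinuousMap ∈
      (fun f : C(I, E) ↦ pVariation p ⟨f⟩) ⁻¹' Set.Ioi v :=
    hball (Metric.mem_ball.2 (by rwa [dist_comm] at hφ))
  have hlt : v < pVariation p (γ'.reparam φ) := hmem
  rwa [pVariation_reparam] at hlt

/-- Curves at reparametrisation distance zero have the same `p`-variation (they have the same
neighbourhoods, and `V_p` is lower semicontinuous); this makes `V_p` a functional on curves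
modulo reparametrisation (Friz–Victoir 2010, Remark 1.22 with Lemma 5.12). [cite: FrizVictoir2010, Lemma 5.12] -/
theorem pVariation_eq_of_dist_eq_zero (p : ℝ) {γ₁ γ₂ : Curve E} (h : dist γ₁ γ₂ = 0) :
    pVariation p γ₁ = pVariation p γ₂ := by
  have key : ∀ {γ₁ γ₂ : Curve E}, dist γ₁ γ₂ = 0 → pVariation p γ₁ ≤ pVariation p γ₂ := by
    intro γ₁ γ₂ h
    refine le_of_forall_lt fun v hv ↦ ?_
    have hev := lowerSemicontinuous_pVariation p γ₁ v hv
    rw [(Metric.inseparable_iff.2 h).nhds_eq] at hev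
    exact hev.self_of_nhds
  exact le_antisymm (key h) (key (by rwa [dist_comm]))

/-- Sublevel sets `{γ | V_p(γ) ≤ M}` are closed in curve space (lower semicontinuity;
Friz–Victoir 2010, Lemma 5.12). [cite: FrizVictoir2010, Lemma 5.12] -/
theorem isClosed_setOf_pVariation_le (p : ℝ) (M : ℝ≥0∞) :
    IsClosed {γ : Curve E | pVariation p γ ≤ M} :=
  (lowerSemicontinuous_pVariation p).isClosed_preimage M

/-- `V_p` is Borel measurable on curve space (lower semicontinuous functions are measurable;
Friz–Victoir 2010, Lemma 5.12). [cite: FrizVictoir2010, Lemma 5.12] -/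
@[fun_prop] theorem measurable_pVariation (p : ℝ) :
    Measurable (pVariation p : Curve E → ℝ≥0∞) :=
  (lowerSemicontinuous_pVariation p).measurable

end Metric

/-! ### Finite `p`-variation is a tortuosity bound -/

section Tortuosity

variable [PseudoMetricSpace E] {γ : Curve E} {a p : ℝ}

/-- **Stopping points of the greedy first-exit algorithm are `a`-separated along the curve**,
so `m` genuine stops cost at least `m · a ^ p` of `p`-variation:
`m · a ^ p ≤ V_p(γ)` whenever `t_1, …, t_m` exist (`Curve.IsStop`). (Aizenman–Burchard 1999,
§2.b: `M̃(C, ℓ)` points at successive distance `≥ ℓ`.) [cite: AizenmanBurchardDuke1999, §2.b] -/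
theorem IsStop.natCast_mul_rpow_le_pVariation (ha : 0 < a) (hp : 0 ≤ p) {m : ℕ}
    (h : γ.IsStop a m) : (m : ℝ≥0∞) * ENNReal.ofReal a ^ p ≤ pVariation p γ := by
  set u : ℕ → I := fun i ↦ γ.stopSeq a (min i m) with hu
  have hum : Monotone u := fun i j hij ↦
    (h.of_le (min_le_right j m)).stopSeq_le ha (min_le_min_right m hij)
  calc (m : ℝ≥0∞) * ENNReal.ofReal a ^ p = ∑ _i ∈ Finset.range m, ENNReal.ofReal a ^ p := by
        simp
    _ ≤ ∑ i ∈ Finset.range m, edist (γ (u (i + 1))) (γ (u i)) ^ p := by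
        refine Finset.sum_le_sum fun i hi ↦ ?_
        rw [Finset.mem_range] at hi
        have h1 : u (i + 1) = γ.stopSeq a (i + 1) := by
          simp [hu, min_eq_left (Nat.succ_le_of_lt hi)]
        have h0 : u i = γ.stopSeq a i := by simp [hu, min_eq_left hi.le]
        rw [h1, h0, edist_dist]
        exact ENNReal.rpow_le_rpow
          (ENNReal.ofReal_le_ofReal (h.of_le (Nat.succ_le_of_lt hi)).le_dist_stopSeq_succ) hp
    _ ≤ pVariation p γ := sum_le_pVariation p γ m hum

/-- **The greedy division** (the division step of AB99 eq. (2.22), isolated): if some index is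
not a stopping index of the greedy first-exit algorithm at scale `a > 0`, then with `m ≥ 1` the
first such index, `t_0, …, t_{m-1}` are genuine stops and `{t_0, …, t_{m-1}, 1}` is a division of
`γ` into at most `m` segments of size `≤ 2a`. (Aizenman–Burchard, Duke Math. J. 99 (1999), proof
of Thm 2.5, eq. (2.22).) [cite: AizenmanBurchardDuke1999, Thm 2.5 eq. (2.22)] -/
theorem exists_isDivision_of_not_isStop (ha : 0 < a) {n : ℕ} (hn : ¬ γ.IsStop a n) :
    ∃ m, 0 < m ∧ m ≤ n ∧ γ.IsStop a (m - 1) ∧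
      ∃ P, γ.IsDivision (2 * a) P ∧ P.card ≤ m + 1 := by
  classical
  have hex : ∃ n, ¬ γ.IsStop a n := ⟨n, hn⟩
  set m := Nat.find hex with hm
  have hm_not : ¬ γ.IsStop a m := Nat.find_spec hex
  have hm_stop : ∀ k, k < m → γ.IsStop a k := fun k hk ↦ by
    have := Nat.find_min hex (m := k) hk
    tauto
  have hm_pos : 0 < m := by
    rw [hm, Nat.find_pos]
    exact fun h ↦ h isStop_zero
  have hm_le : m ≤ n := Nat.find_min' hex hn
  -- the last stopping time has no exit
  have hlast : ¬ (γ.exitSet a (γ.stopSeq a (m - 1))).Nonempty := by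
    intro hne
    refine hm_not fun i hi ↦ ?_
    rcases (Nat.le_of_lt_succ (by omega : i < m - 1 + 1)).lt_or_eq with hlt | rfl
    · exact hm_stop (m - 1) (Nat.sub_lt hm_pos Nat.one_pos) i hlt
    · exact hne
  refine ⟨m, hm_pos, hm_le, hm_stop _ (Nat.sub_lt hm_pos Nat.one_pos),
    (Finset.range m).image (γ.stopSeq a) ∪ {1}, ⟨?_, by simp, ?_⟩, ?_⟩
  · exact Finset.mem_union_left _ (Finset.mem_image.2 ⟨0, by simpa using hm_pos, rfl⟩)
  · intro s u hsu hP
    -- the last stopping index `k ≤ m - 1` with `t_k ≤ s`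
    set k := Nat.findGreatest (fun k ↦ γ.stopSeq a k ≤ s) (m - 1) with hk
    have hks : γ.stopSeq a k ≤ s :=
      Nat.findGreatest_spec (P := fun k ↦ γ.stopSeq a k ≤ s) (Nat.zero_le _) (by simp)
    have hkm : k ≤ m - 1 := Nat.findGreatest_le _
    have hsd : ∀ v : I, γ.stopSeq a k ≤ v → (k + 1 ≤ m - 1 → v ≤ γ.stopSeq a (k + 1)) →
        dist (γ v) (γ (γ.stopSeq a k)) ≤ a := by
      intro v hv1 hv2
      rcases hkm.lt_or_eq with hlt | heq
      · have hst : γ.IsStop a (k + 1) := hm_stop _ (by omega)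
        exact hst.dist_le_of_mem_Icc ha hv1 (hv2 (by omega))
      · have : ¬ (γ.exitSet a (γ.stopSeq a k)).Nonempty := heq ▸ hlast
        exact (dist_lt_of_not_nonempty this hv1).le
    have hnext : k + 1 ≤ m - 1 → u ≤ γ.stopSeq a (k + 1) := by
      intro hk1
      have hgt : s < γ.stopSeq a (k + 1) := by
        by_contra hle
        exact Nat.findGreatest_is_greatest (P := fun k ↦ γ.stopSeq a k ≤ s) (Nat.lt_succ_self k)
          hk1 (not_lt.1 hle)
      rcases hP (γ.stopSeq a (k + 1)) (Finset.mem_union_left _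
        (Finset.mem_image.2 ⟨k + 1, by simp; omega, rfl⟩)) with h' | h'
      · exact absurd h' (not_le.2 hgt)
      · exact h'
    calc dist (γ s) (γ u)
        ≤ dist (γ s) (γ (γ.stopSeq a k)) + dist (γ u) (γ (γ.stopSeq a k)) :=
          dist_triangle_right _ _ _
      _ ≤ a + a := add_le_add (hsd s hks fun h ↦ hsu.trans (hnext h))
          (hsd u (hks.trans hsu) hnext)
      _ = 2 * a := by ring
  · calc ((Finset.range m).image (γ.stopSeq a) ∪ {1}).card
        ≤ ((Finset.range m).image (γ.stopSeq a)).card + ({1} : Finset I).card :=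
          Finset.card_union_le _ _
      _ ≤ m + 1 := by
          gcongr
          · exact Finset.card_image_le.trans (by simp)
          · simp

/-- **Finite `p`-variation is a tortuosity bound**: for every `ℓ > 0` and `p ≥ 0`,
`M(γ, 2ℓ) ≤ V_p(γ) / ℓ ^ p + 1` in `[0, ∞]` (trivial if `V_p(γ) = ∞`). Run the greedy first-exit
algorithm at scale `ℓ`: if it stopped for ever, `m ℓ ^ p ≤ V_p` for all `m` would force
`V_p = ∞`; otherwise its `m` stops give a division into `≤ m` pieces of size `≤ 2ℓ` and
`(m - 1) ℓ ^ p ≤ V_p`. (Aizenman–Burchard 1999, §2.b: `M(C, 3ℓ) ≤ M̃(C, ℓ)`, with `M̃(C, ℓ)` the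
maximal number of successively `ℓ`-separated points, `≤ V_p / ℓ ^ p + 1`; the greedy division of
the proof of Thm 2.5 improves `3ℓ` to `2ℓ`.) [cite: AizenmanBurchardDuke1999, §2.b and Thm 2.5 eq. (2.22)] -/
theorem natCast_tortuosity_le_pVariation_div_add_one (γ : Curve E) (hp : 0 ≤ p) {ℓ : ℝ}
    (hℓ : 0 < ℓ) :
    (γ.tortuosity (2 * ℓ) : ℝ≥0∞) ≤ pVariation p γ / ENNReal.ofReal ℓ ^ p + 1 := by
  have hℓp : ENNReal.ofReal ℓ ^ p ≠ 0 :=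
    (ENNReal.rpow_pos (ENNReal.ofReal_pos.2 hℓ) ENNReal.ofReal_ne_top).ne'
  have hℓp' : ENNReal.ofReal ℓ ^ p ≠ ⊤ := ENNReal.rpow_ne_top_of_nonneg hp ENNReal.ofReal_ne_top
  by_cases hall : ∀ n, γ.IsStop ℓ n
  · -- the algorithm never stops: infinite variation
    have htop : pVariation p γ = ⊤ := by
      by_contra hne
      obtain ⟨n, hn⟩ := ENNReal.exists_nat_gt (ENNReal.div_ne_top hne hℓp)
      rw [ENNReal.div_lt_iff (Or.inl hℓp) (Or.inl hℓp')] at hn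
      exact (hn.trans_le ((hall n).natCast_mul_rpow_le_pVariation hℓ hp)).false
    rw [htop, ENNReal.top_div_of_ne_top hℓp', top_add]
    exact le_top
  · push Not at hall
    obtain ⟨n, hn⟩ := hall
    obtain ⟨m, hm0, -, hstop, P, hP, hcard⟩ := exists_isDivision_of_not_isStop hℓ hn
    have htort : γ.tortuosity (2 * ℓ) ≤ m := by
      have := hP.tortuosity_lt_card
      omega
    have hdiv : ((m - 1 : ℕ) : ℝ≥0∞) ≤ pVariation p γ / ENNReal.ofReal ℓ ^ p := by
      rw [ENNReal.le_div_iff_mul_le (Or.inl hℓp) (Or.inl hℓp')]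
      exact hstop.natCast_mul_rpow_le_pVariation hℓ hp
    calc (γ.tortuosity (2 * ℓ) : ℝ≥0∞) ≤ (m : ℝ≥0∞) := by exact_mod_cast htort
      _ = ((m - 1 : ℕ) : ℝ≥0∞) + 1 := by norm_cast; omega
      _ ≤ pVariation p γ / ENNReal.ofReal ℓ ^ p + 1 := add_le_add hdiv le_rfl

end Tortuosity

end Curve

/-! ### The functional on curves modulo reparametrisation -/

namespace CurveClass

variable [PseudoMetricSpace E]

/-- The `p`-variation of a curve class: the `p`-variation of any representative (well defined by
`Curve.pVariation_eq_of_dist_eq_zero`) (Friz–Victoir 2010, Def. 5.1 with Remark 1.22). [cite: FrizVictoir2010, Def. 5.1 (5.2)] -/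
def pVariation (p : ℝ) : CurveClass E → ℝ≥0∞ :=
  SeparationQuotient.lift (Curve.pVariation p) fun _ _ h ↦
    Curve.pVariation_eq_of_dist_eq_zero p (Metric.inseparable_iff.1 h)

/-- The `p`-variation of the class of `γ` is `V_p(γ)` (Friz–Victoir 2010, Def. 5.1). [cite: FrizVictoir2010, Def. 5.1 (5.2)] -/
@[simp] theorem pVariation_mk (p : ℝ) (γ : Curve E) : pVariation p (mk γ) = γ.pVariation p := rfl

/-- The `p`-variation of a class is that of the representative `(surjective_mk x).choose` — the
`rep` inlined in the items of route `SAWExpectedSignature` (Friz–Victoir 2010, Def. 5.1). [cite: FrizVictoir2010, Def. 5.1 (5.2)] -/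
theorem pVariation_choose (p : ℝ) (x : CurveClass E) :
    (surjective_mk x).choose.pVariation p = pVariation p x := by
  calc (surjective_mk x).choose.pVariation p = pVariation p (mk (surjective_mk x).choose) := rfl
    _ = pVariation p x := by rw [(surjective_mk x).choose_spec]

/-- **Lower semicontinuity of `V_p` on the space of curves modulo reparametrisation**: the
quotient map is open, so this is `Curve.lowerSemicontinuous_pVariation`
(Friz–Victoir 2010, Lemma 5.12). [cite: FrizVictoir2010, Lemma 5.12] -/
theorem lowerSemicontinuous_pVariation (p : ℝ) :
    LowerSemicontinuous (pVariation p : CurveClass E → ℝ≥0∞) := by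
  intro x v hv
  obtain ⟨γ, rfl⟩ := surjective_mk x
  have h := Curve.lowerSemicontinuous_pVariation p γ v hv
  change ∀ᶠ y in 𝓝 (SeparationQuotient.mk γ), v < pVariation p y
  rw [← SeparationQuotient.map_mk_nhds, Filter.eventually_map]
  exact h

/-- Sublevel sets `{x | V_p(x) ≤ M}` are closed in the space of curves modulo
reparametrisation (so, by portmanteau, `V_p`-moment bounds pass to weak limits)
(Friz–Victoir 2010, Lemma 5.12). [cite: FrizVictoir2010, Lemma 5.12] -/
theorem isClosed_setOf_pVariation_le (p : ℝ) (M : ℝ≥0∞) :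
    IsClosed {x : CurveClass E | pVariation p x ≤ M} :=
  (lowerSemicontinuous_pVariation p).isClosed_preimage M

/-- `V_p` is Borel measurable on the space of curves modulo reparametrisation
(Friz–Victoir 2010, Lemma 5.12). [cite: FrizVictoir2010, Lemma 5.12] -/
@[fun_prop] theorem measurable_pVariation (p : ℝ) :
    Measurable (pVariation p : CurveClass E → ℝ≥0∞) :=
  (lowerSemicontinuous_pVariation p).measurable

/-- **Bounded `p`-variation in a compact set is relatively compact modulo reparametrisation**:
for `Λ ⊆ E` compact (`E` complete), `p ≥ 0` and `M < ∞`, the classes of the curves `γ` with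
`range γ ⊆ Λ` and `V_p(γ) ≤ M` form a relatively compact subset of `CurveClass E`. By
`Curve.natCast_tortuosity_le_pVariation_div_add_one` these curves obey the uniform tortuosity
bounds `M(γ, 2/(i+1)) ≤ ⌊M (i+1) ^ p + 1⌋` at all scales, so AB99 Lemma 4.1
(`CurveClass.isCompact_closure_image_mk_of_tortuosity_le`) applies.
(Aizenman–Burchard, Duke Math. J. 99 (1999), Lemma 4.1.) [cite: AizenmanBurchardDuke1999, Lemma 4.1] -/
theorem isCompact_closure_image_mk_of_pVariation_le [CompleteSpace E] {Λ : Set E}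
    (hΛ : IsCompact Λ) {p : ℝ} (hp : 0 ≤ p) {M : ℝ≥0∞} (hM : M ≠ ⊤) :
    IsCompact (closure (mk '' {γ : Curve E | γ.range ⊆ Λ ∧ γ.pVariation p ≤ M})) := by
  set L : ℕ → ℝ := fun i ↦ 2 * (1 / ((i : ℝ) + 1)) with hL
  set B : ℕ → ℝ≥0∞ := fun i ↦ M / ENNReal.ofReal (1 / ((i : ℝ) + 1)) ^ p + 1 with hB
  have hBtop : ∀ i, B i ≠ ⊤ := fun i ↦ by
    refine ENNReal.add_ne_top.2 ⟨ENNReal.div_ne_top hM ?_, ENNReal.one_ne_top⟩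
    exact (ENNReal.rpow_pos (ENNReal.ofReal_pos.2 (by positivity)) ENNReal.ofReal_ne_top).ne'
  set Φ : ℕ → ℕ := fun i ↦ ⌊(B i).toNNReal⌋₊ with hΦ
  have hsub : {γ : Curve E | γ.range ⊆ Λ ∧ γ.pVariation p ≤ M} ⊆
      {γ | γ.range ⊆ Λ ∧ ∀ i, γ.tortuosity (L i) ≤ Φ i} := by
    rintro γ ⟨hΛγ, hV⟩
    refine ⟨hΛγ, fun i ↦ ?_⟩
    have h1 : (γ.tortuosity (L i) : ℝ≥0∞) ≤ B i := by
      refine (γ.natCast_tortuosity_le_pVariation_div_add_one hp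
        (by positivity : (0 : ℝ) < 1 / ((i : ℝ) + 1))).trans ?_
      exact add_le_add (ENNReal.div_le_div_right hV _) le_rfl
    apply Nat.le_floor
    rw [← ENNReal.coe_le_coe, ENNReal.coe_toNNReal (hBtop i)]
    exact_mod_cast h1
  refine (isCompact_closure_image_mk_of_tortuosity_le hΛ L Φ fun η hη ↦ ?_).of_isClosed_subset
    isClosed_closure (closure_mono (Set.image_mono hsub))
  obtain ⟨i, hi⟩ := exists_nat_gt (2 / η)
  have h2 : 2 < (i : ℝ) * η := (div_lt_iff₀ hη).1 hi
  refine ⟨i, by positivity, ?_⟩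
  rw [hL]
  dsimp only
  rw [mul_one_div, div_le_iff₀ (by positivity : (0 : ℝ) < (i : ℝ) + 1)]
  nlinarith

end CurveClass

end Literature.Probability.RandomPlanarGeometry
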